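import Summits.QuantumFields.YangMills.Theorems.LuscherReductionTwistedTraceScalingPointwiseSuperRiccati
import Summits.QuantumFields.YangMills.Theorems.LuscherReductionTwistedTraceScalingValleySkeleton
import Summits.QuantumFields.YangMills.Theorems.LuscherReductionTwistedTraceScalingToronValley
import HarnessLib

/-!
# Lane B's Riccati super-solution bound in ZERO-POINT currency: the normal-mode product is `√(π/b')^{3|E|}·e^{3|E|·modeZPE(tμ/b')}·e^{−zpeSum L (t/b') U}`
# (lane A of S-BASE, crux `TwistedTraceScaling` stmt-QuantumFields-20203; the first brick of the BO sub-target `ValleyBOWeakAt`, design note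
# `pub/ym-fleet/ym-luscher-20007-p1/COARSE-DESIGN.md` §16–§17)

Lane B's ★★★ `Cov.transferApply_riccatiTrial_le` bounds `(K_β H)(U)` by a `U`-independent prefactor times the normal-mode product
`Πᵢ √(π/(tλᵢ + b' + g(λᵢ)λᵢ²))` over the Gram eigenvalues `λᵢ` of `D_U = covCurl U`, `g = riccatiWeight t b' μ`.  Here that product is put in the currency of the
C3 skeleton (`…ValleySkeleton`, `zpeSum`):
* `Frame.isDiag_gramEigenvectorBasis` — lane B's Gram eigenframe is a diagonalising frame, so `Σᵢ modeZPE(κλᵢ) = zpeSum L κ U` (`sum_modeZPE_gram_eq_zpeSum`);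
* ★ `sqrt_pi_div_riccati_le` — per mode, `√(π/(tλ + b + g(λ)λ²)) ≤ √(π/b)·e^{−modeZPE((t/b)λ)}·e^{modeZPE(tμ/b)}`: EQUALITY without the last factor on stiff modes
  `λ ≥ μ` (the weight is exactly Riccati there, `riccatiWeight_riccati` + the per-mode bridge `sqrt_pi_div_eq`), and on soft modes `λ < μ` the deficiency is at most
  `e^{modeZPE(tμ/b)}` (monotonicity of `modeZPE`);
* ★★ `prod_sqrt_pi_div_riccati_le`, `prod_gram_riccati_le_zpeSum` — the product form; `zpeSum_mono` — `zpeSum` is monotone in `κ`;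
* ★★★ `transferApply_riccatiTrial_le_zpe` — lane B's bound with the product replaced:
  `(K_β H)(U) ≤ Pref(β,ρ,σ,μ,L)·√(π/b')^{3|E|}·e^{3|E|·modeZPE(μ(1+ρ²)²/2)}·e^{−zpeSum L (1/2) U}·H(U) + e^{2β|E|}e^{−2βδ}` (`t/b' = (1+ρ²)²/2 ≥ 1/2`).
What is still between this and `ValleyBOWeakAt L (β^{−p}) (β^{−q})`: the scale choice `σ = 2β^{−q}`, `ρ(β)`, `μ(β)` making `Pref·e^{3|E|·modeZPE(…μ…)}` match the
k = 0 floor up to `e^{o(β^{−p})}`, the far-tail absorption (`H ≥ c` on the valley), and measurability of `stiffTrial` (lane B's hypothesis (m5)).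
HONEST FRAMING: fixed-lattice bookkeeping for a stub lane of a child of the CONDITIONAL reduction route (femto rung R2b1); not infinite volume, not a gap, not Clay.
-/

set_option autoImplicit false

noncomputable section

open MeasureTheory Real Module Finset
open scoped BigOperators RealInnerProductSpace
open Literature.MathematicalPhysics.QuantumFieldTheory
open Literature.MathematicalPhysics.QuantumLattice

namespace Summit.QuantumFields.YangMills.Theorems.FemtoTransferGap

open TwoLattice TwoLattice.Toron TwoLattice.Cov TwoLattice.Stiff TwoLattice.Harm TwoLattice.GnChart

/-! ## §1 Lane B's Gram eigenframe is a diagonalising frame -/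

/-- The orthonormal eigenbasis of the Gram matrix of `D` diagonalises the form of `D`, with values the Gram eigenvalues. [cite: HornJohnson2013, Thm 7.3.2] -/
theorem Frame.isDiag_gramEigenvectorBasis {n : Type*} [Fintype n] [DecidableEq n] {W : Type*} [NormedAddCommGroup W] [InnerProductSpace ℝ W]
    [FiniteDimensional ℝ W] (D : EuclideanSpace ℝ n →ₗ[ℝ] W) :
    Frame.IsDiag D (gramMatrix_isHermitian D).eigenvectorBasis (fun i => (gramMatrix_isHermitian D).eigenvalues i) := by
  refine Frame.isDiag_of_apply_eq_smul (T := D.adjoint ∘ₗ D) (fun x y => ?_) fun i => ?_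
  · rw [LinearMap.comp_apply, LinearMap.adjoint_inner_right]
  · rw [LinearMap.comp_apply, gram_frame D i]
    simp

variable {L : ℕ} [NeZero L]

/-- `Σᵢ modeZPE(κ·λᵢ(D_U†D_U)) = zpeSum L κ U` over lane B's Gram eigenvalues. [cite: HornJohnson2013, Thm 2.5.4] -/
theorem sum_modeZPE_gram_eq_zpeSum (U : GaugeConfig 3 L SU2) (κ : ℝ) :
    ∑ i, modeZPE (κ * (gramMatrix_isHermitian (covCurl U)).eigenvalues i) = zpeSum L κ U := by
  classical
  exact sum_modeZPE_eq_zpeSum L (Frame.isDiag_gramEigenvectorBasis (covCurl U)) κ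

/-- `zpeSum` is monotone in `κ ≥ 0`. [folklore] -/
theorem zpeSum_mono (U : GaugeConfig 3 L SU2) {κ κ' : ℝ} (hκ : 0 ≤ κ) (hκκ' : κ ≤ κ') : zpeSum L κ U ≤ zpeSum L κ' U := by
  unfold zpeSum
  refine sum_le_sum fun i _ => modeZPE_le_modeZPE (by positivity) ?_
  exact mul_le_mul_of_nonneg_right hκκ' (sq_nonneg _)

/-! ## §2 The per-mode bound -/

/-- ★ **Per mode**: `√(π/(tλ + b + g(λ)λ²)) ≤ √(π/b)·e^{−modeZPE((t/b)λ)}·e^{modeZPE(tμ/b)}` for `g = riccatiWeight t b μ`, `λ ≥ 0`, `t ≥ 0`, `b, μ > 0`.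
[cite: Wipf2021, §8.5.1 (8.56)–(8.58)] -/
theorem sqrt_pi_div_riccati_le {t b μ lam : ℝ} (ht : 0 ≤ t) (hb : 0 < b) (hμ : 0 < μ) (hlam : 0 ≤ lam) :
    Real.sqrt (Real.pi / (t * lam + b + riccatiWeight t b μ lam * lam ^ 2)) ≤
      Real.sqrt (Real.pi / b) * Real.exp (-modeZPE (t / b * lam)) * Real.exp (modeZPE (t * μ / b)) := by
  have hE : 1 ≤ Real.exp (modeZPE (t * μ / b)) := Real.one_le_exp (modeZPE_nonneg (by positivity))
  have hab : t / b * lam = t * lam / b := by ring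
  by_cases hμl : μ ≤ lam
  · -- stiff mode: exactly Riccati
    have hc0 : 0 ≤ riccatiWeight t b μ lam * lam ^ 2 := mul_nonneg (riccatiWeight_nonneg hμ lam) (sq_nonneg _)
    have hcsq := riccatiWeight_riccati (t := t) (b := b) hμ ht hb.le hμl
    rw [sqrt_pi_div_eq (a := t * lam) (by positivity) hb hc0 hcsq, hab]
    exact le_mul_of_one_le_right (by positivity) hE
  · -- soft mode: drop `tλ + g(λ)λ² ≥ 0`, then monotonicity of `modeZPE`
    push Not at hμl
    have hg0 : 0 ≤ riccatiWeight t b μ lam * lam ^ 2 := mul_nonneg (riccatiWeight_nonneg hμ lam) (sq_nonneg _)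
    have hden : b ≤ t * lam + b + riccatiWeight t b μ lam * lam ^ 2 := by nlinarith
    have h1 : Real.sqrt (Real.pi / (t * lam + b + riccatiWeight t b μ lam * lam ^ 2)) ≤ Real.sqrt (Real.pi / b) :=
      Real.sqrt_le_sqrt (div_le_div_of_nonneg_left Real.pi_pos.le hb hden)
    refine h1.trans ?_
    have hm : modeZPE (t / b * lam) ≤ modeZPE (t * μ / b) := by
      refine modeZPE_le_modeZPE (by positivity) ?_
      rw [hab]
      exact div_le_div_of_nonneg_right (mul_le_mul_of_nonneg_left hμl.le ht) hb.le
    have h2 : 1 ≤ Real.exp (-modeZPE (t / b * lam)) * Real.exp (modeZPE (t * μ / b)) := by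
      rw [← Real.exp_add]
      exact Real.one_le_exp (by linarith)
    calc Real.sqrt (Real.pi / b) = Real.sqrt (Real.pi / b) * 1 := (mul_one _).symm
      _ ≤ Real.sqrt (Real.pi / b) * (Real.exp (-modeZPE (t / b * lam)) * Real.exp (modeZPE (t * μ / b))) :=
          mul_le_mul_of_nonneg_left h2 (Real.sqrt_nonneg _)
      _ = _ := by ring

/-- ★★ **Product form**: `Πᵢ √(π/(tλᵢ + b + g(λᵢ)λᵢ²)) ≤ √(π/b)^{|ι|}·e^{−Σᵢ modeZPE((t/b)λᵢ)}·e^{|ι|·modeZPE(tμ/b)}`. [cite: Wipf2021, §8.5.1 (8.56)–(8.58)] -/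
theorem prod_sqrt_pi_div_riccati_le {ι : Type*} [Fintype ι] {lam : ι → ℝ} {t b μ : ℝ} (hlam : ∀ i, 0 ≤ lam i) (ht : 0 ≤ t) (hb : 0 < b)
    (hμ : 0 < μ) :
    ∏ i, Real.sqrt (Real.pi / (t * lam i + b + riccatiWeight t b μ (lam i) * lam i ^ 2)) ≤
      Real.sqrt (Real.pi / b) ^ Fintype.card ι * Real.exp (-∑ i, modeZPE (t / b * lam i)) * Real.exp (Fintype.card ι * modeZPE (t * μ / b)) := by
  calc ∏ i, Real.sqrt (Real.pi / (t * lam i + b + riccatiWeight t b μ (lam i) * lam i ^ 2))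
      ≤ ∏ i, Real.sqrt (Real.pi / b) * Real.exp (-modeZPE (t / b * lam i)) * Real.exp (modeZPE (t * μ / b)) :=
        prod_le_prod (fun i _ => Real.sqrt_nonneg _) fun i _ => sqrt_pi_div_riccati_le ht hb hμ (hlam i)
    _ = Real.sqrt (Real.pi / b) ^ Fintype.card ι * Real.exp (-∑ i, modeZPE (t / b * lam i)) * Real.exp (Fintype.card ι * modeZPE (t * μ / b)) := by
        rw [prod_mul_distrib, prod_mul_distrib, prod_const, prod_const, card_univ, ← Real.exp_sum, ← Real.exp_nat_mul, sum_neg_distrib]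

/-- ★★ **At `U`**: lane B's normal-mode product over the Gram eigenvalues of `D_U` is at most `√(π/b)^{3|E|}·e^{3|E|·modeZPE(tμ/b)}·e^{−zpeSum L (t/b) U}`.
[cite: Wipf2021, §8.5.1 (8.56)–(8.58)] [cite: Luscher1983, §3] -/
theorem prod_gram_riccati_le_zpeSum (U : GaugeConfig 3 L SU2) {t b μ : ℝ} (ht : 0 ≤ t) (hb : 0 < b) (hμ : 0 < μ) :
    ∏ i, Real.sqrt (Real.pi / (t * (gramMatrix_isHermitian (covCurl U)).eigenvalues i + b +
        riccatiWeight t b μ ((gramMatrix_isHermitian (covCurl U)).eigenvalues i) * (gramMatrix_isHermitian (covCurl U)).eigenvalues i ^ 2)) ≤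
      Real.sqrt (Real.pi / b) ^ (Fintype.card (Edge 3 L) * 3) * Real.exp ((Fintype.card (Edge 3 L) * 3 : ℕ) * modeZPE (t * μ / b)) *
        Real.exp (-zpeSum L (t / b) U) := by
  have h := prod_sqrt_pi_div_riccati_le (fun i => gram_eigenvalues_nonneg (covCurl U) i) ht hb hμ
  rw [sum_modeZPE_gram_eq_zpeSum U (t / b)] at h
  have hcard : Fintype.card (Edge 3 L × Fin 3) = Fintype.card (Edge 3 L) * 3 := by rw [Fintype.card_prod, Fintype.card_fin]
  rw [hcard] at h
  simpa only [mul_assoc, mul_comm, mul_left_comm] using h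

/-! ## §3 ★★★ Lane B's super-solution bound in zero-point currency -/

/-- ★★★ **POINTWISE SUPER-SOLUTION BOUND, RICCATI WEIGHT, ZPE CURRENCY.**  Under lane B's hypotheses (`β > 0`, `δ < 1`, `0 ≤ ρ ≤ 1/100`, `(1−δ)⁻² − 1 ≤ ρ²`,
`σ ≤ 1/16`, `μ > 0`, `H = stiffTrial (riccatiWeight (β/2) (β(1+ρ²)⁻²) μ)` measurable, `S(U) ≤ σ`):
`(K_β H)(U) ≤ Pref · √(π/b')^{3|E|} · e^{3|E|·modeZPE((β/2)μ/b')} · e^{−zpeSum L (1/2) U} · H(U) + e^{2β|E|} e^{−2βδ}`, `b' = β/(1+ρ²)²`, with lane B's `Pref`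
(`(2π²)^{−|E|} e^{2β|E|} e^{(β/2)(η₁+θ)} e^{E}`).  The `U`-dependence is ONLY through `zpeSum L (1/2) U` and `H(U)`. [cite: Luscher1983, §3] [cite: Wipf2021, §8.5.2] -/
theorem transferApply_riccatiTrial_le_zpe {β δ ρ σ μ : ℝ} (hβ : 0 < β) (hδ : δ < 1) (hρ0 : 0 ≤ ρ) (hρ : ρ ≤ 1 / 100)
    (hρδ : ((1 - δ) ^ 2)⁻¹ - 1 ≤ ρ ^ 2) (hσ : σ ≤ 1 / 16) (hμ : 0 < μ)
    (hH : Measurable (stiffTrial (L := L) (riccatiWeight (β / 2) (β / (1 + ρ ^ 2) ^ 2) μ))) (U : GaugeConfig 3 L SU2)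
    (hS : wilsonAction su2Rep U ≤ σ) :
    transferApply β (stiffTrial (riccatiWeight (β / 2) (β / (1 + ρ ^ 2) ^ 2) μ)) U ≤
      ((2 * π ^ 2)⁻¹) ^ Fintype.card (Edge 3 L) * Real.exp (2 * β) ^ Fintype.card (Edge 3 L) *
          Real.exp (β / 2 * (stepErrLo ρ σ (Fintype.card (Plaquette 3 L × Fin 3)) + chartErr ρ σ (Fintype.card (Plaquette 3 L × Fin 3)))) *
          Real.exp (trialErr ρ σ (Fintype.card (Plaquette 3 L × Fin 3)) (Fintype.card (Edge 3 L × Fin 3))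
            (Real.sqrt ((β / 2) ^ 2 + 2 * (β / 2) * (β / (1 + ρ ^ 2) ^ 2) / μ) / μ)
            (Real.sqrt ((β / 2) ^ 2 + 2 * (β / 2) * (β / (1 + ρ ^ 2) ^ 2) / μ))
            (3 * (β / 2) / μ ^ 2 + 3 * (β / (1 + ρ ^ 2) ^ 2) / μ ^ 3)) *
          (Real.sqrt (Real.pi / (β / (1 + ρ ^ 2) ^ 2)) ^ (Fintype.card (Edge 3 L) * 3) *
            Real.exp ((Fintype.card (Edge 3 L) * 3 : ℕ) * modeZPE (β / 2 * μ / (β / (1 + ρ ^ 2) ^ 2))) *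
            Real.exp (-zpeSum L (1 / 2) U)) *
          stiffTrial (riccatiWeight (β / 2) (β / (1 + ρ ^ 2) ^ 2) μ) U +
        Real.exp (2 * β) ^ Fintype.card (Edge 3 L) * Real.exp (-(2 * β * δ)) := by
  have hmain := transferApply_riccatiTrial_le hβ hδ hρ0 hρ hρδ hσ hμ hH U hS
  refine hmain.trans (add_le_add (mul_le_mul_of_nonneg_right (mul_le_mul_of_nonneg_left ?_ (by positivity)) (stiffTrial_pos _ U).le) le_rfl)
  have ht : (0 : ℝ) ≤ β / 2 := by positivity
  have hb : 0 < β / (1 + ρ ^ 2) ^ 2 := by positivity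
  refine (prod_gram_riccati_le_zpeSum U ht hb hμ).trans (mul_le_mul_of_nonneg_left ?_ (by positivity))
  -- `t/b' = (1+ρ²)²/2 ≥ 1/2`
  refine Real.exp_le_exp.2 (neg_le_neg (zpeSum_mono U (by norm_num) ?_))
  rw [div_div_eq_mul_div, le_div_iff₀ hβ]
  have h1 : 1 ≤ (1 + ρ ^ 2) ^ 2 := by nlinarith [sq_nonneg ρ]
  nlinarith

end Summit.QuantumFields.YangMills.Theorems.FemtoTransferGap

end
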